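import Summits.AtomisticToContinuum.Crystallization.Theses.SurfaceTensionNoFoam

/-!
# Route `SurfaceTensionNoFoam`, item stmt-AtomisticToContinuum-13454 `ExposedCostGivesNoFoam` — PROVED

`ExposedCostGivesNoFoam := ExposedSitesCost → CrysEnergyLimit → NoFoam` (support item, "provable-now" on the route card):
with the hole scale `r₀` of `ExposedSitesCost` and its price `c = c(R)`, along any ground-state sequence
`0 ≤ #exposed_N / N ≤ (E(N)/N − e⋆)/c → 0` (squeeze; the two exposure predicates are syntactically identical).  0 sorry.

Filed by the lens-5 decomposition seat (generation 21) as the route-level half of the COHESION CONCORDANCE between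
`LoopTunnelDial.PocketCase`'s residual core TENUOUS and this route's exposed-sites currency: the same squeeze at a FIXED hole
scale `r₀ ≤ 32/33` (kit 9 `LoopTunnelDialCohesionDial.fractionSmall_of_costAt`, against the LANDED `CrysEnergyLimit`) empties the
TENUOUS world.  `exposedSitesCost_of_fixedScale` records the one-line direction FIXED SCALE ⟹ 13448.  (With the landed
`CrysEnergyLimit_holds`, `NoFoam` (13453) follows from `ExposedSitesCost` (13448) alone: `exposedCostGivesNoFoam_proof h CrysEnergyLimit_holds` —
not stated as a declaration here so that no conditional proof of 13453 enters the tree.)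
-/

namespace Summit.AtomisticToContinuum.Crystallization.Theorems

open Filter Topology
open Literature.MathematicalPhysics.StatisticalMechanics
open Summit.AtomisticToContinuum.Crystallization.Theses.SurfaceTensionNoFoam
  (ExposedSitesCost CrysEnergyLimit NoFoam ExposedCostGivesNoFoam)

/-- **Item `stmt-AtomisticToContinuum-13454` (`ExposedCostGivesNoFoam`) for route `SurfaceTensionNoFoam`: PROVED (squeeze).** -/
theorem exposedCostGivesNoFoam_proof :
    Summit.AtomisticToContinuum.Crystallization.Theses.SurfaceTensionNoFoam.ExposedCostGivesNoFoam := by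
  intro hC hL
  obtain ⟨r₀, hr₀, hc⟩ := hC
  refine ⟨r₀, hr₀, fun R hR x hx => ?_⟩
  obtain ⟨c, hc0, hcN⟩ := hc R hR
  have hL' : Tendsto (fun N : ℕ => groundStateEnergy lennardJones 3 N / N) atTop
      (𝓝 (⨅ Q : PeriodicConfiguration 3, Q.energyPerParticle lennardJones)) := hL
  set e : ℝ := ⨅ Q : PeriodicConfiguration 3, Q.energyPerParticle lennardJones with he
  have hu : Tendsto (fun N : ℕ => (groundStateEnergy lennardJones 3 N / N - e) / c) atTop (𝓝 0) := by
    have h := (hL'.sub_const e).div_const c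
    simpa using h
  refine tendsto_of_tendsto_of_tendsto_of_le_of_le' tendsto_const_nhds hu
    (Eventually.of_forall fun N => by positivity) ?_
  filter_upwards [eventually_ge_atTop 1] with N hN
  have hNr : (0 : ℝ) < N := by exact_mod_cast hN
  have h := hcN N (x N) (hx N)
  rw [div_le_div_iff₀ hNr hc0]
  have hmul : (groundStateEnergy lennardJones 3 N / N - e) * N = groundStateEnergy lennardJones 3 N - (N : ℝ) * e := by
    field_simp
  rw [hmul]
  linarith

/-- **Fixed hole scale ⟹ item 13448.**  `ExposedSitesCost` with its `∃ r₀` witnessed at a GIVEN `0 < r₀` (the shape in which the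
`LoopTunnelDial` cohesion dial consumes it, at `r₀ ≤ 32/33`) implies `ExposedSitesCost` as typed (`∃`-introduction). -/
theorem exposedSitesCost_of_fixedScale {r₀ : ℝ} (hr₀ : 0 < r₀)
    (h : ∀ R : ℝ, 0 < R → ∃ c : ℝ, 0 < c ∧ ∀ (N : ℕ) (x : Fin N → EuclideanSpace ℝ (Fin 3)),
      IsGroundState lennardJones x →
        c * (Nat.card {i : Fin N // ∃ p : EuclideanSpace ℝ (Fin 3), dist p (x i) ≤ R ∧ ∀ j : Fin N, r₀ ≤ dist p (x j)} : ℝ) ≤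
          groundStateEnergy lennardJones 3 N - (N : ℝ) * (⨅ Q : PeriodicConfiguration 3, Q.energyPerParticle lennardJones)) :
    Summit.AtomisticToContinuum.Crystallization.Theses.SurfaceTensionNoFoam.ExposedSitesCost :=
  ⟨r₀, hr₀, h⟩

end Summit.AtomisticToContinuum.Crystallization.Theorems
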